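import Mathlib
import Literature.NumberTheory.Transcendental.DrinfeldAssociatorRegularisation
import Literature.NumberTheory.Transcendental.DrinfeldAssociatorTransport

/-!
# Toolkit for the pentagon equation: truncated norms, pushforwards, embeddings

Support file for the proof of the pentagon equation for `Φ_KZ = drinfeldAssociator`
(`DrinfeldAssociator.lean`).  Elementary bookkeeping on non-commutative series
`NCSeries α ℝ` over a finite alphabet:

1. the truncated `ℓ¹`-seminorm `tn N S = Σ_{|W| ≤ N} |S W|`: subadditive, submultiplicative
   (`tn_mul_le`), a product-perturbation bound (`tn_prod_add_sub_prod_le`), and the polynomial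
   bounds `‖exp(ℓ c)‖_N ≤ (N+1)(1+|ℓ|)^N`,
   `‖exp(ℓ c) - exp(ℓ₀ c)‖_N ≤ (N+1) N |ℓ-ℓ₀| (1+|ℓ|+|ℓ₀|)^N`
   (only words of length `≤ N` count, so no genuine exponential growth appears), and the group law
   `exp((ℓ+ℓ') c) = exp(ℓ c) exp(ℓ' c)` (`expLetter_add`);
2. pushforwards `NCSeries.push m` along linear substitutions of letters
   (`AssociatorsPairing.lean`): the closed form on tuples, **evaluation of a pushforward is
   evaluation with pushed letters** (`evalTrunc_push`), the norm bound `‖push m φ‖_N ≤ C_m^N ‖φ‖_N`,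
   and **multilinearity of Chen's transport** (`transportSeries_eq_push`): if the densities are
   `F_ℓ = Σ_c m(c, ℓ) G_c` then `T̂^F = push m T̂^G`;
3. the embedding `emb ι` of series along an injection of alphabets (`= push` of a 0/1 matrix):
   it restricts to the given series on the image and vanishes elsewhere, and
   `evalTrunc N v (emb ι φ) = evalTrunc N (v ∘ ι) φ`.

## References
* V. G. Drinfeld, *On quasitriangular quasi-Hopf algebras and on a group that is closely
  connected with Gal(Q̄/Q)*, Leningrad Math. J. 2 (1991), §2. [Drinfeld1991]
* C. Reutenauer, *Free Lie algebras*, Oxford 1993, Ch. 1, 3 (series, shuffles, substitutions).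
  [Reutenauer1993]
-/

noncomputable section

open MeasureTheory intervalIntegral Set Filter
open scoped BigOperators Topology

namespace Literature.NumberTheory.Transcendental

namespace NCSeries

universe u v
variable {α : Type u} [Fintype α] [DecidableEq α]

/-! ## 1. The truncated `ℓ¹`-seminorm `‖S‖_N = Σ_{|W| ≤ N} |S(W)|` -/

/-- The truncated `ℓ¹`-seminorm of a real series: `tn N S = Σ_{|W| ≤ N} |S W|`. [folklore] -/
def tn (N : ℕ) (S : NCSeries α ℝ) : ℝ := ∑ W ∈ wordsLE α N, |S W|

/-- `‖S‖_N ≥ 0`. [folklore] -/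
theorem tn_nonneg (N : ℕ) (S : NCSeries α ℝ) : 0 ≤ tn N S :=
  Finset.sum_nonneg fun _ _ => abs_nonneg _

/-- Each coefficient of weight `≤ N` is bounded by `‖S‖_N`. [folklore] -/
theorem abs_le_tn {N : ℕ} (S : NCSeries α ℝ) {W : List α} (hW : W.length ≤ N) : |S W| ≤ tn N S :=
  Finset.single_le_sum (f := fun W => |S W|) (fun _ _ => abs_nonneg _) (mem_wordsLE.mpr hW)

/-- Triangle inequality for `‖·‖_N`. [folklore] -/
theorem tn_add_le (N : ℕ) (S T : NCSeries α ℝ) : tn N (S + T) ≤ tn N S + tn N T := by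
  unfold tn; rw [← Finset.sum_add_distrib]
  exact Finset.sum_le_sum fun W _ => abs_add_le _ _

/-- `‖-S‖_N = ‖S‖_N`. [folklore] -/
theorem tn_neg (N : ℕ) (S : NCSeries α ℝ) : tn N (-S) = tn N S := by
  unfold tn; simp

/-- `‖S - T‖_N ≤ ‖S‖_N + ‖T‖_N`. [folklore] -/
theorem tn_sub_le (N : ℕ) (S T : NCSeries α ℝ) : tn N (S - T) ≤ tn N S + tn N T := by
  rw [sub_eq_add_neg]; exact (tn_add_le N S _).trans (by rw [tn_neg])

/-- `‖c • S‖_N = |c| ‖S‖_N`. [folklore] -/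
theorem tn_smul (N : ℕ) (c : ℝ) (S : NCSeries α ℝ) : tn N (c • S) = |c| * tn N S := by
  unfold tn; rw [Finset.mul_sum]; simp [abs_mul]

/-- `‖0‖_N = 0`. [folklore] -/
@[simp] theorem tn_zero (N : ℕ) : tn N (0 : NCSeries α ℝ) = 0 := by simp [tn]

/-- `‖Σ Sᵢ‖_N ≤ Σ ‖Sᵢ‖_N`. [folklore] -/
theorem tn_sum_le (N : ℕ) {ι : Type*} (s : Finset ι) (S : ι → NCSeries α ℝ) :
    tn N (∑ i ∈ s, S i) ≤ ∑ i ∈ s, tn N (S i) := by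
  classical
  induction s using Finset.induction_on with
  | empty => simp
  | insert i s hi ih =>
    rw [Finset.sum_insert hi, Finset.sum_insert hi]
    exact (tn_add_le _ _ _).trans (by linarith)

/-- `‖S‖_N = 0` iff `S` vanishes in weight `≤ N`. [folklore] -/
theorem tn_eq_zero_iff {N : ℕ} {S : NCSeries α ℝ} :
    tn N S = 0 ↔ ∀ W : List α, W.length ≤ N → S W = 0 := by
  unfold tn
  rw [Finset.sum_eq_zero_iff_of_nonneg fun _ _ => abs_nonneg _]
  simp only [abs_eq_zero, mem_wordsLE]

/-- The unit series has norm `1`. [folklore] -/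
@[simp] theorem tn_one (N : ℕ) : tn N (1 : NCSeries α ℝ) = 1 := by
  classical
  unfold tn
  rw [Finset.sum_eq_single_of_mem [] (by simp) fun W _ hW => ?_]
  · simp
  · cases W with
    | nil => exact absurd rfl hW
    | cons a W => simp

/-- A sum over the words of length `≤ N` is a sum over lengths and tuples. [folklore] -/
theorem sum_wordsLE_eq_sum_range {M : Type*} [AddCommMonoid M] (N : ℕ) (F : List α → M) :
    ∑ W ∈ wordsLE α N, F W = ∑ n ∈ Finset.range (N + 1), ∑ x : Fin n → α, F (List.ofFn x) := by
  unfold wordsLE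
  rw [Finset.sum_biUnion]
  · exact Finset.sum_congr rfl fun n _ => (sum_fin_eq_sum_wordsOfLength n F).symm
  · intro m _ n _ hmn
    rw [Function.onFun, Finset.disjoint_left]
    intro w hm hn
    rw [mem_wordsOfLength] at hm hn
    exact hmn (hm.symm.trans hn)

/-- Reindexing a double sum over words and their deconcatenations as a sum over pairs. [folklore] -/
theorem sum_wordsLE_sum_splits {M : Type*} [AddCommMonoid M] (N : ℕ)
    (F : List α × List α → M) :
    ∑ W ∈ wordsLE α N, ∑ p ∈ splits W, F p =
      ∑ p ∈ (wordsLE α N ×ˢ wordsLE α N).filter (fun p => p.1.length + p.2.length ≤ N), F p := by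
  have hset : (wordsLE α N ×ˢ wordsLE α N).filter
      (fun p : List α × List α => p.1.length + p.2.length ≤ N) = (wordsLE α N).biUnion splits := by
    ext ⟨u, u'⟩
    simp only [Finset.mem_filter, Finset.mem_product, mem_wordsLE, Finset.mem_biUnion, mem_splits]
    constructor
    · rintro ⟨-, h⟩; exact ⟨u ++ u', by simpa using h, rfl⟩
    · rintro ⟨w, hw, rfl⟩; simp only [List.length_append] at hw; omega
  rw [hset, Finset.sum_biUnion]
  intro w _ w' _ hne
  rw [Function.onFun, Finset.disjoint_left]
  intro p hp hp'
  rw [mem_splits] at hp hp'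
  exact hne (hp.symm.trans hp')

/-- **Submultiplicativity**: `‖S T‖_N ≤ ‖S‖_N ‖T‖_N`. [folklore] -/
theorem tn_mul_le (N : ℕ) (S T : NCSeries α ℝ) : tn N (S * T) ≤ tn N S * tn N T := by
  unfold tn
  calc ∑ W ∈ wordsLE α N, |(S * T) W|
      ≤ ∑ W ∈ wordsLE α N, ∑ p ∈ splits W, |S p.1| * |T p.2| := by
        refine Finset.sum_le_sum fun W _ => ?_
        rw [mul_apply]
        exact (Finset.abs_sum_le_sum_abs _ _).trans
          (le_of_eq (Finset.sum_congr rfl fun p _ => abs_mul _ _))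
    _ = ∑ p ∈ (wordsLE α N ×ˢ wordsLE α N).filter (fun p => p.1.length + p.2.length ≤ N),
          |S p.1| * |T p.2| := sum_wordsLE_sum_splits N _
    _ ≤ ∑ p ∈ wordsLE α N ×ˢ wordsLE α N, |S p.1| * |T p.2| :=
        Finset.sum_le_sum_of_subset_of_nonneg (Finset.filter_subset _ _) fun _ _ _ => by positivity
    _ = (∑ W ∈ wordsLE α N, |S W|) * ∑ W ∈ wordsLE α N, |T W| := by
        rw [Finset.sum_product, Finset.sum_mul_sum]

/-- `‖S^m‖_N ≤ ‖S‖_N^m`. [folklore] -/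
theorem tn_pow_le (N : ℕ) (S : NCSeries α ℝ) : ∀ m : ℕ, tn N (S ^ m) ≤ tn N S ^ m
  | 0 => by simp
  | m + 1 => by
    rw [pow_succ, pow_succ]
    exact (tn_mul_le N _ _).trans (mul_le_mul_of_nonneg_right (tn_pow_le N S m) (tn_nonneg _ _))

/-- `‖∏ Sⱼ‖_N ≤ ∏ ‖Sⱼ‖_N`. [folklore] -/
theorem tn_list_prod_le (N : ℕ) : ∀ L : List (NCSeries α ℝ),
    tn N L.prod ≤ (L.map (tn N)).prod
  | [] => by simp
  | S :: L => by
    rw [List.prod_cons, List.map_cons, List.prod_cons]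
    exact (tn_mul_le N _ _).trans (mul_le_mul_of_nonneg_left (tn_list_prod_le N L) (tn_nonneg _ _))

/-- **Product perturbation**: `‖∏(Bⱼ + Eⱼ) - ∏ Bⱼ‖ ≤ ∏(‖Bⱼ‖ + ‖Eⱼ‖) - ∏ ‖Bⱼ‖`. [folklore] -/
theorem tn_prod_add_sub_prod_le (N : ℕ) : ∀ L : List (NCSeries α ℝ × NCSeries α ℝ),
    tn N ((L.map fun p => p.1 + p.2).prod - (L.map fun p => p.1).prod) ≤
      (L.map fun p => tn N p.1 + tn N p.2).prod - (L.map fun p => tn N p.1).prod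
  | [] => by simp
  | (B, E) :: L => by
    simp only [List.map_cons, List.prod_cons]
    set PA := (L.map fun p => p.1 + p.2).prod
    set PB := (L.map fun p => p.1).prod
    set pa := (L.map fun p => tn N p.1 + tn N p.2).prod
    set pb := (L.map fun p => tn N p.1).prod
    have ih := tn_prod_add_sub_prod_le N L
    have hpb : tn N PB ≤ pb := (tn_list_prod_le N _).trans (by rw [List.map_map]; rfl)
    have hpb0 : 0 ≤ pb := List.prod_nonneg (by
      intro z hz; obtain ⟨p, -, rfl⟩ := List.mem_map.mp hz; exact tn_nonneg _ _)
    have hpa : pb ≤ pa := list_prod_map_le_prod_map L (fun p _ => tn_nonneg _ _)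
      fun p _ => le_add_of_nonneg_right (tn_nonneg _ _)
    have hsplit : (B + E) * PA - B * PB = (B + E) * (PA - PB) + E * PB := by noncomm_ring
    rw [hsplit]
    calc tn N ((B + E) * (PA - PB) + E * PB)
        ≤ tn N ((B + E) * (PA - PB)) + tn N (E * PB) := tn_add_le _ _ _
      _ ≤ (tn N B + tn N E) * (pa - pb) + tn N E * pb := by
          refine add_le_add ((tn_mul_le _ _ _).trans (mul_le_mul (tn_add_le _ _ _) ih
            (tn_nonneg _ _) (add_nonneg (tn_nonneg _ _) (tn_nonneg _ _))))
            ((tn_mul_le _ _ _).trans (mul_le_mul_of_nonneg_left hpb (tn_nonneg _ _)))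
      _ = (tn N B + tn N E) * pa - tn N B * pb := by ring

omit [Fintype α] in
/-- `exp(0 · c) = 1`. [folklore] -/
theorem expLetter_zero (c : α) : Shuffle.expLetter c (0 : ℝ) = 1 := by
  ext w
  unfold Shuffle.expLetter
  cases w with
  | nil => simp
  | cons a w =>
    rw [one_apply_cons]
    split_ifs with h
    · simp
    · rfl

omit [Fintype α] in
/-- **`exp((ℓ + ℓ') c) = exp(ℓ c) exp(ℓ' c)`** (binomial theorem on the powers of one letter).
[folklore] -/
theorem expLetter_add (c : α) (ℓ ℓ' : ℝ) :
    Shuffle.expLetter c (ℓ + ℓ') = Shuffle.expLetter c ℓ * Shuffle.expLetter c ℓ' := by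
  ext W
  by_cases hW : ∃ a ∈ W, a ≠ c
  · obtain ⟨a, haW, hac⟩ := hW
    rw [Shuffle.expLetter_eq_zero_of_mem c _ haW hac, mul_apply, eq_comm]
    refine Finset.sum_eq_zero fun p hp => ?_
    rw [mem_splits] at hp
    rw [← hp, List.mem_append] at haW
    rcases haW with h | h
    · rw [Shuffle.expLetter_eq_zero_of_mem c _ h hac, zero_mul]
    · rw [Shuffle.expLetter_eq_zero_of_mem c _ h hac, mul_zero]
  · push Not at hW
    have hWr : W = List.replicate W.length c := List.eq_replicate_iff.mpr ⟨rfl, hW⟩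
    rw [hWr, mul_apply, sum_splits_eq_sum_range, List.length_replicate, Shuffle.expLetter_replicate]
    simp only [List.take_replicate, List.drop_replicate, Shuffle.expLetter_replicate, eq_ratCast,
      Rat.cast_div, Rat.cast_one, Rat.cast_natCast]
    rw [add_pow, Finset.mul_sum]
    refine Finset.sum_congr rfl fun i hi => ?_
    have hi' : i ≤ W.length := Nat.lt_succ_iff.mp (Finset.mem_range.mp hi)
    rw [Nat.min_eq_left hi']
    have key : ((W.length.choose i : ℕ) : ℝ) * (i.factorial : ℝ) * ((W.length - i).factorial : ℝ) =
        (W.length.factorial : ℝ) := by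
      exact_mod_cast Nat.choose_mul_factorial_mul_factorial hi'
    have h1 : (i.factorial : ℝ) ≠ 0 := by positivity
    have h2 : ((W.length - i).factorial : ℝ) ≠ 0 := by positivity
    have h3 : (W.length.factorial : ℝ) ≠ 0 := by positivity
    field_simp
    linear_combination (ℓ ^ i * ℓ' ^ (W.length - i)) * key

/-- `‖exp(ℓ c)‖_N ≤ Σ_{n ≤ N} |ℓ|ⁿ/n! ≤ (1 + |ℓ|)^N · (N+1)` (crude). [folklore] -/
theorem tn_expLetter_le (N : ℕ) (c : α) (ℓ : ℝ) :
    tn N (Shuffle.expLetter c ℓ) ≤ (N + 1) * (1 + |ℓ|) ^ N := by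
  classical
  unfold tn
  -- only the words c^n, n ≤ N, contribute, each at most (1+|ℓ|)^N
  have hterm : ∀ W ∈ wordsLE α N, |Shuffle.expLetter c ℓ W| ≤
      if W = List.replicate W.length c then (1 + |ℓ|) ^ N else 0 := by
    intro W hW
    rw [mem_wordsLE] at hW
    unfold Shuffle.expLetter
    split_ifs with h
    · rw [abs_mul, abs_pow]
      have h1 : |algebraMap ℚ ℝ (1 / (W.length.factorial : ℚ))| ≤ 1 := by
        rw [eq_ratCast, Rat.cast_div, Rat.cast_one, Rat.cast_natCast, abs_of_pos (by positivity)]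
        exact div_le_one_of_le₀
          (by exact_mod_cast Nat.one_le_iff_ne_zero.mpr (Nat.factorial_ne_zero _)) (by positivity)
      calc |algebraMap ℚ ℝ (1 / (W.length.factorial : ℚ))| * |ℓ| ^ W.length
          ≤ 1 * (1 + |ℓ|) ^ W.length :=
            mul_le_mul h1 (pow_le_pow_left₀ (abs_nonneg _) (by linarith [abs_nonneg ℓ]) _)
              (by positivity) zero_le_one
        _ ≤ (1 + |ℓ|) ^ N := by
            rw [one_mul]; exact pow_le_pow_right₀ (by linarith [abs_nonneg ℓ]) hW
    · simp
  refine (Finset.sum_le_sum hterm).trans ?_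
  rw [Finset.sum_ite, Finset.sum_const_zero, add_zero, Finset.sum_const, nsmul_eq_mul]
  refine mul_le_mul_of_nonneg_right ?_ (by positivity)
  -- the words that are powers of c and of length ≤ N are at most N+1
  have hsub : (wordsLE α N).filter (fun W => W = List.replicate W.length c) ⊆
      (Finset.range (N + 1)).image fun n => List.replicate n c := by
    intro W hW
    rw [Finset.mem_filter, mem_wordsLE] at hW
    exact Finset.mem_image.mpr ⟨W.length, Finset.mem_range.mpr (by omega), hW.2.symm⟩
  calc (((wordsLE α N).filter fun W => W = List.replicate W.length c).card : ℝ)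
      ≤ ((Finset.range (N + 1)).image fun n => List.replicate n c).card := by
        exact_mod_cast Finset.card_le_card hsub
    _ ≤ (Finset.range (N + 1)).card := by exact_mod_cast Finset.card_image_le
    _ = N + 1 := by simp

/-- `‖exp(ℓ c) - exp(ℓ₀ c)‖_N ≤ (N+1) · N |ℓ - ℓ₀| (1 + |ℓ| + |ℓ₀|)^N`. [folklore] -/
theorem tn_expLetter_sub_le (N : ℕ) (c : α) (ℓ ℓ₀ : ℝ) :
    tn N (Shuffle.expLetter c ℓ - Shuffle.expLetter c ℓ₀) ≤
      (N + 1) * (N * |ℓ - ℓ₀| * (1 + |ℓ| + |ℓ₀|) ^ N) := by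
  classical
  unfold tn
  have hB1 : 1 ≤ 1 + |ℓ| + |ℓ₀| := by linarith [abs_nonneg ℓ, abs_nonneg ℓ₀]
  have hMB : max |ℓ| |ℓ₀| ≤ 1 + |ℓ| + |ℓ₀| :=
    max_le (by linarith [abs_nonneg ℓ₀]) (by linarith [abs_nonneg ℓ])
  have hterm : ∀ W ∈ wordsLE α N, |(Shuffle.expLetter c ℓ - Shuffle.expLetter c ℓ₀) W| ≤
      if W = List.replicate W.length c then N * |ℓ - ℓ₀| * (1 + |ℓ| + |ℓ₀|) ^ N else 0 := by
    intro W hW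
    rw [mem_wordsLE] at hW
    rw [sub_apply]
    split_ifs with h
    · rw [h, Shuffle.expLetter_replicate, Shuffle.expLetter_replicate, ← mul_sub, abs_mul]
      have h1 : |algebraMap ℚ ℝ (1 / (W.length.factorial : ℚ))| ≤ 1 := by
        rw [eq_ratCast, Rat.cast_div, Rat.cast_one, Rat.cast_natCast, abs_of_pos (by positivity)]
        exact div_le_one_of_le₀
          (by exact_mod_cast Nat.one_le_iff_ne_zero.mpr (Nat.factorial_ne_zero _)) (by positivity)
      have hM : max |ℓ| |ℓ₀| ^ (W.length - 1) ≤ (1 + |ℓ| + |ℓ₀|) ^ N :=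
        (pow_le_pow_left₀ (by positivity) hMB _).trans (pow_le_pow_right₀ hB1 (by omega))
      calc |algebraMap ℚ ℝ (1 / (W.length.factorial : ℚ))| * |ℓ ^ W.length - ℓ₀ ^ W.length|
          ≤ 1 * (|ℓ - ℓ₀| * W.length * max |ℓ| |ℓ₀| ^ (W.length - 1)) :=
            mul_le_mul h1 (abs_pow_sub_pow_le _ _ _) (abs_nonneg _) zero_le_one
        _ ≤ 1 * (|ℓ - ℓ₀| * N * (1 + |ℓ| + |ℓ₀|) ^ N) := by
            refine mul_le_mul_of_nonneg_left (mul_le_mul (mul_le_mul_of_nonneg_left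
              (by exact_mod_cast hW) (abs_nonneg _)) hM (by positivity) (by positivity)) zero_le_one
        _ = N * |ℓ - ℓ₀| * (1 + |ℓ| + |ℓ₀|) ^ N := by ring
    · unfold Shuffle.expLetter
      rw [if_neg h, if_neg h, sub_zero, abs_zero]
  refine (Finset.sum_le_sum hterm).trans ?_
  rw [Finset.sum_ite, Finset.sum_const_zero, add_zero, Finset.sum_const, nsmul_eq_mul]
  refine mul_le_mul_of_nonneg_right ?_ (by positivity)
  have hsub : (wordsLE α N).filter (fun W => W = List.replicate W.length c) ⊆
      (Finset.range (N + 1)).image fun n => List.replicate n c := by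
    intro W hW
    rw [Finset.mem_filter, mem_wordsLE] at hW
    exact Finset.mem_image.mpr ⟨W.length, Finset.mem_range.mpr (by omega), hW.2.symm⟩
  calc (((wordsLE α N).filter fun W => W = List.replicate W.length c).card : ℝ)
      ≤ ((Finset.range (N + 1)).image fun n => List.replicate n c).card := by
        exact_mod_cast Finset.card_le_card hsub
    _ ≤ (Finset.range (N + 1)).card := by exact_mod_cast Finset.card_image_le
    _ = N + 1 := by simp

end NCSeries

namespace NCSeries

universe u' v'
variable {α : Type u'} [Fintype α] {β : Type v'} [Fintype β]

/-! ## 2. Pushforwards along linear substitutions of letters -/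

-- buildfix (Literature FQN clash #4 = DUP-FQN set 019): `NCSeries.push_ofFn` / `NCSeries.evalTrunc_push` are ALSO declared (general field `K`)
-- by `AssociatorsDefectSeriesProofs.lean`, so the two modules could not be co-imported (`Literature` root aggregate).  This module's two `ℝ`
-- versions therefore live as private lemmas in the sub-namespace `NCSeries.Toolkit` (declaration texts unchanged) and are re-exported under
-- their old names as ALIASES, so every use below and in the importer `DrinfeldAssociatorPentagonProofs` resolves unchanged.
namespace Toolkit

omit [Fintype α] in
/-- Closed form of the pushforward on a word given as `List.ofFn`. [folklore] -/
private theorem push_ofFn (m : β → α → ℝ) : ∀ (n : ℕ) (φ : NCSeries β ℝ) (x : Fin n → α),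
    push m φ (List.ofFn x) = ∑ w : Fin n → β, φ (List.ofFn w) * ∏ i, m (w i) (x i)
  | 0, φ, x => by simp
  | n + 1, φ, x => by
    rw [List.ofFn_succ, push_cons, sum_fin_succ_fun]
    refine Finset.sum_congr rfl fun b _ => ?_
    rw [push_ofFn m n (lderiv b φ) (fun i => x i.succ), Finset.mul_sum]
    refine Finset.sum_congr rfl fun w _ => ?_
    rw [Fin.prod_univ_succ, lderiv_apply, List.ofFn_succ]
    simp only [Fin.cons_zero, Fin.cons_succ]
    ring

end Toolkit

export Toolkit (push_ofFn)

/-- Expansion of a list product of finite sums (noncommutative). [folklore] -/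
theorem prod_ofFn_sum {A : Type*} [Semiring A] : ∀ (n : ℕ) (g : Fin n → α → A),
    (List.ofFn fun i => ∑ f, g i f).prod = ∑ x : Fin n → α, (List.ofFn fun i => g i (x i)).prod
  | 0, g => by simp
  | n + 1, g => by
    rw [List.ofFn_succ, List.prod_cons, prod_ofFn_sum n (fun i => g i.succ), Finset.sum_mul_sum,
      sum_fin_succ_fun n (fun x => (List.ofFn fun i => g i (x i)).prod)]
    refine Finset.sum_congr rfl fun a _ => Finset.sum_congr rfl fun x _ => ?_
    rw [List.ofFn_succ, List.prod_cons]
    simp only [Fin.cons_zero, Fin.cons_succ]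

omit [Fintype α] in
/-- Scalars pull out of a list product in an algebra. [folklore] -/
theorem prod_ofFn_smul {A : Type*} [Semiring A] [Algebra ℝ A] :
    ∀ (n : ℕ) (r : Fin n → ℝ) (a : Fin n → A),
    (List.ofFn fun i => r i • a i).prod = (∏ i, r i) • (List.ofFn a).prod
  | 0, r, a => by simp
  | n + 1, r, a => by
    rw [List.ofFn_succ, List.prod_cons, prod_ofFn_smul n (fun i => r i.succ) (fun i => a i.succ),
      Fin.prod_univ_succ, List.ofFn_succ, List.prod_cons, smul_mul_smul_comm]

-- buildfix (clash #4): see `NCSeries.Toolkit.push_ofFn` above.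
namespace Toolkit

/-- **Evaluation of a pushforward = evaluation with pushed letters**:
`ev_v(push m φ) = ev_{b ↦ Σ_f m(b,f) v(f)}(φ)`. [folklore] -/
private theorem evalTrunc_push {A : Type*} [Semiring A] [Algebra ℝ A] (N : ℕ) (v : α → A) (m : β → α → ℝ)
    (φ : NCSeries β ℝ) :
    evalTrunc N v (push m φ) = evalTrunc N (fun b => ∑ f, m b f • v f) φ := by
  unfold evalTrunc
  refine Finset.sum_congr rfl fun n _ => ?_
  simp only [List.map_ofFn]
  calc ∑ x : Fin n → α, push m φ (List.ofFn x) • (List.ofFn (v ∘ x)).prod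
      = ∑ x : Fin n → α, ∑ w : Fin n → β,
          (φ (List.ofFn w) * ∏ i, m (w i) (x i)) • (List.ofFn (v ∘ x)).prod := by
        refine Finset.sum_congr rfl fun x _ => ?_
        rw [push_ofFn, Finset.sum_smul]
    _ = ∑ w : Fin n → β, φ (List.ofFn w) •
          ∑ x : Fin n → α, (∏ i, m (w i) (x i)) • (List.ofFn (v ∘ x)).prod := by
        rw [Finset.sum_comm]
        refine Finset.sum_congr rfl fun w _ => ?_
        rw [Finset.smul_sum]
        refine Finset.sum_congr rfl fun x _ => ?_
        rw [mul_smul]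
    _ = ∑ w : Fin n → β, φ (List.ofFn w) • (List.ofFn ((fun b => ∑ f, m b f • v f) ∘ w)).prod := by
        refine Finset.sum_congr rfl fun w _ => ?_
        congr 1
        rw [show (List.ofFn ((fun b => ∑ f, m b f • v f) ∘ w)) =
            List.ofFn fun i => ∑ f, m (w i) f • v f from rfl,
          prod_ofFn_sum]
        refine Finset.sum_congr rfl fun x _ => ?_
        rw [prod_ofFn_smul]
        rfl

end Toolkit

export Toolkit (evalTrunc_push)

omit [Fintype α] in
/-- `push` commutes with negation. [folklore] -/
theorem push_neg_eq (m : β → α → ℝ) (φ : NCSeries β ℝ) : push m (-φ) = -push m φ := by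
  ext x
  rw [← neg_one_smul ℝ φ, push_smul, neg_apply, neg_one_mul]

omit [Fintype α] in
/-- `push` commutes with subtraction. [folklore] -/
theorem push_sub_eq (m : β → α → ℝ) (φ ψ : NCSeries β ℝ) :
    push m (φ - ψ) = push m φ - push m ψ := by
  ext x
  rw [sub_eq_add_neg, push_add, push_neg_eq, sub_apply, neg_apply, sub_eq_add_neg]

omit [Fintype α] in
/-- `push` is additive (function form). [folklore] -/
theorem push_add_eq (m : β → α → ℝ) (φ ψ : NCSeries β ℝ) :
    push m (φ + ψ) = push m φ + push m ψ := by
  ext x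
  rw [push_add, add_apply]

/-- The constant of a substitution matrix: `1 + Σ_{b,f} |m(b,f)|`. [folklore] -/
def pushConst (m : β → α → ℝ) : ℝ := 1 + ∑ b, ∑ f, |m b f|

/-- `C_m ≥ 1`. [folklore] -/
theorem one_le_pushConst (m : β → α → ℝ) : 1 ≤ pushConst m :=
  le_add_of_nonneg_right (Finset.sum_nonneg fun _ _ => Finset.sum_nonneg fun _ _ => abs_nonneg _)

/-- Each row sum `Σ_f |m(b,f)|` is at most `C_m`. [folklore] -/
theorem sum_abs_le_pushConst (m : β → α → ℝ) (b : β) : ∑ f, |m b f| ≤ pushConst m :=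
  (Finset.single_le_sum (f := fun b => ∑ f, |m b f|)
    (fun _ _ => Finset.sum_nonneg fun _ _ => abs_nonneg _)
    (Finset.mem_univ b)).trans (le_add_of_nonneg_left zero_le_one)

/-- **`‖push m φ‖_N ≤ C_m^N ‖φ‖_N`.** [folklore] -/
theorem tn_push_le [DecidableEq α] [DecidableEq β] (N : ℕ) (m : β → α → ℝ) (φ : NCSeries β ℝ) :
    tn N (push m φ) ≤ pushConst m ^ N * tn N φ := by
  unfold tn
  rw [sum_wordsLE_eq_sum_range, sum_wordsLE_eq_sum_range, Finset.mul_sum]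
  refine Finset.sum_le_sum fun n hn => ?_
  rw [Finset.mem_range] at hn
  calc ∑ x : Fin n → α, |push m φ (List.ofFn x)|
      ≤ ∑ x : Fin n → α, ∑ w : Fin n → β, |φ (List.ofFn w)| * ∏ i, |m (w i) (x i)| := by
        refine Finset.sum_le_sum fun x _ => ?_
        rw [push_ofFn]
        refine (Finset.abs_sum_le_sum_abs _ _).trans (le_of_eq (Finset.sum_congr rfl fun w _ => ?_))
        rw [abs_mul, Finset.abs_prod]
    _ = ∑ w : Fin n → β, |φ (List.ofFn w)| * ∏ i, ∑ f, |m (w i) f| := by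
        rw [Finset.sum_comm]
        refine Finset.sum_congr rfl fun w _ => ?_
        rw [← Finset.mul_sum, Finset.prod_univ_sum]
        simp only [Fintype.piFinset_univ]
    _ ≤ ∑ w : Fin n → β, |φ (List.ofFn w)| * pushConst m ^ N := by
        refine Finset.sum_le_sum fun w _ => mul_le_mul_of_nonneg_left ?_ (abs_nonneg _)
        calc ∏ i, ∑ f, |m (w i) f| ≤ ∏ _i : Fin n, pushConst m :=
              Finset.prod_le_prod (fun i _ => Finset.sum_nonneg fun _ _ => abs_nonneg _)
                fun i _ => sum_abs_le_pushConst m (w i)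
          _ = pushConst m ^ n := by simp
          _ ≤ pushConst m ^ N := pow_le_pow_right₀ (one_le_pushConst m) (by omega)
    _ = pushConst m ^ N * ∑ w : Fin n → β, |φ (List.ofFn w)| := by
        rw [Finset.mul_sum]; simp [mul_comm]

omit [Fintype α] in
/-- **Multilinearity of the transport**: if `F_ℓ = Σ_c m(c,ℓ) G_c` then `T̂^F = push m T̂^G`.
[folklore] -/
theorem iterInt_linComb (m : β → α → ℝ) {G : β → ℝ → ℝ} {s : Set ℝ} (hs : IsOpen s)
    (hso : s.OrdConnected) (hG : ∀ c, ContinuousOn (G c) s) {a : ℝ} (ha : a ∈ s) :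
    ∀ (n : ℕ) (x : Fin n → α) {b : ℝ}, b ∈ s →
      iterInt (fun ℓ t => ∑ c, m c ℓ * G c t) (List.ofFn x) a b =
        ∑ w : Fin n → β, (∏ i, m (w i) (x i)) * iterInt G (List.ofFn w) a b
  | 0, x, b, _ => by simp
  | n + 1, x, b, hb => by
    rw [List.ofFn_succ, iterInt_cons, sum_fin_succ_fun]
    have hcongr : ∀ t ∈ uIcc a b, (∑ c, m c (x 0) * G c t) *
        iterInt (fun ℓ t => ∑ c, m c ℓ * G c t) (List.ofFn fun i => x i.succ) a t =
        ∑ c, ∑ w : Fin n → β,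
          (m c (x 0) * ∏ i, m (w i) (x i.succ)) * (G c t * iterInt G (List.ofFn w) a t) := by
      intro t ht
      rw [iterInt_linComb m hs hso hG ha n (fun i => x i.succ) (hso.uIcc_subset ha hb ht),
        Finset.sum_mul_sum]
      refine Finset.sum_congr rfl fun c _ => Finset.sum_congr rfl fun w _ => by ring
    rw [intervalIntegral.integral_congr hcongr, intervalIntegral.integral_finsetSum fun c _ => ?_]
    · refine Finset.sum_congr rfl fun c _ => ?_
      rw [intervalIntegral.integral_finsetSum fun w _ => ?_]
      · refine Finset.sum_congr rfl fun w _ => ?_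
        rw [intervalIntegral.integral_const_mul, List.ofFn_succ, iterInt_cons, Fin.prod_univ_succ]
        simp only [Fin.cons_zero, Fin.cons_succ]
      · exact (intervalIntegrable_mul_iterInt hs hso hG ha c _ ha hb).const_mul _
    · have h := IntervalIntegrable.sum (μ := volume) Finset.univ
        fun (w : Fin n → β) (_ : w ∈ Finset.univ) =>
          (intervalIntegrable_mul_iterInt hs hso hG ha c (List.ofFn w) ha hb).const_mul
            (m c (x 0) * ∏ i, m (w i) (x i.succ))
      have hfun : (fun t => ∑ w : Fin n → β, (m c (x 0) * ∏ i, m (w i) (x i.succ)) *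
          (G c t * iterInt G (List.ofFn w) a t)) = ∑ w : Fin n → β,
          fun t => (m c (x 0) * ∏ i, m (w i) (x i.succ)) *
            (G c t * iterInt G (List.ofFn w) a t) := by
        funext t
        exact (Finset.sum_apply t (Finset.univ : Finset (Fin n → β)) (fun w t =>
          (m c (x 0) * ∏ i, m (w i) (x i.succ)) * (G c t * iterInt G (List.ofFn w) a t))).symm
      rw [hfun]
      exact h

omit [Fintype α] in
/-- **Multilinearity of the transport series**: `T̂^{Σ_c m(c,·) G_c} = push m T̂^G`.
[folklore] -/
theorem transportSeries_eq_push (m : β → α → ℝ) {G : β → ℝ → ℝ} {s : Set ℝ} (hs : IsOpen s)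
    (hso : s.OrdConnected) (hG : ∀ c, ContinuousOn (G c) s) {a b : ℝ} (ha : a ∈ s) (hb : b ∈ s) :
    transportSeries (fun ℓ t => ∑ c, m c ℓ * G c t) a b = push m (transportSeries G a b) := by
  ext W
  obtain ⟨n, x, rfl⟩ : ∃ (n : ℕ) (x : Fin n → α), W = List.ofFn x :=
    ⟨W.length, W.get, (List.ofFn_get W).symm⟩
  rw [transportSeries_apply, iterInt_linComb m hs hso hG ha n x hb, push_ofFn]
  exact Finset.sum_congr rfl fun w _ => by rw [transportSeries_apply, mul_comm]

/-! ## 3. Embedding a sub-alphabet -/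

section Emb
variable {γ : Type*} [Fintype γ] [DecidableEq α]

/-- The substitution matrix of an embedding of alphabets. [folklore] -/
def embMat (ι : γ → α) : γ → α → ℝ := fun c ℓ => if ι c = ℓ then 1 else 0

/-- Pushforward of a series along an embedding of alphabets (words outside the image get `0`).
[folklore] -/
def emb (ι : γ → α) (φ : NCSeries γ ℝ) : NCSeries α ℝ := push (embMat ι) φ

omit [Fintype α] in
/-- `emb ι φ (ι ∘ w) = φ w` on tuples. [folklore] -/
theorem emb_ofFn_comp {ι : γ → α} (hι : Function.Injective ι) (φ : NCSeries γ ℝ) {n : ℕ}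
    (w : Fin n → γ) :
    emb ι φ (List.ofFn (ι ∘ w)) = φ (List.ofFn w) := by
  rw [emb, push_ofFn, Finset.sum_eq_single w]
  · simp [embMat]
  · intro w' _ hne
    have : ∃ i, w' i ≠ w i := by
      by_contra h; push Not at h; exact hne (funext h)
    obtain ⟨i, hi⟩ := this
    rw [Finset.prod_eq_zero (Finset.mem_univ i)]
    · ring
    · simp [embMat, hι.ne hi]
  · simp

omit [Fintype α] in
/-- `emb ι φ (ι_* w) = φ w`: the embedding restricts to `φ` on the image. [folklore] -/
theorem emb_map {ι : γ → α} (hι : Function.Injective ι) (φ : NCSeries γ ℝ) (w : List γ) :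
    emb ι φ (w.map ι) = φ w := by
  have h := emb_ofFn_comp hι φ (w.get)
  rwa [← List.map_ofFn, List.ofFn_get] at h

omit [Fintype α] in
/-- `emb ι φ` vanishes on words outside the image of `ι_*`. [folklore] -/
theorem emb_eq_zero_of_not_range {ι : γ → α} (φ : NCSeries γ ℝ) {W : List α}
    (hW : ∀ w : List γ, w.map ι ≠ W) : emb ι φ W = 0 := by
  obtain ⟨n, x, rfl⟩ : ∃ (n : ℕ) (x : Fin n → α), W = List.ofFn x :=
    ⟨W.length, W.get, (List.ofFn_get W).symm⟩
  rw [emb, push_ofFn]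
  refine Finset.sum_eq_zero fun w _ => ?_
  have : ∃ i, ι (w i) ≠ x i := by
    by_contra h; push Not at h
    exact hW (List.ofFn w) (by rw [List.map_ofFn]; exact congrArg _ (funext h))
  obtain ⟨i, hi⟩ := this
  rw [Finset.prod_eq_zero (Finset.mem_univ i) (by simp [embMat, hi]), mul_zero]

/-- Evaluating an embedded series = evaluating the series on the restricted letters.
[folklore] -/
theorem evalTrunc_emb {A : Type*} [Semiring A] [Algebra ℝ A] (N : ℕ) (v : α → A) (ι : γ → α)
    (φ : NCSeries γ ℝ) : evalTrunc N v (emb ι φ) = evalTrunc N (v ∘ ι) φ := by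
  rw [emb, evalTrunc_push]
  congr 1
  funext c
  simp [embMat, ite_smul, Finset.sum_ite_eq]

/-- `‖emb ι φ‖_N ≤ C^N ‖φ‖_N`. [folklore] -/
theorem tn_emb_le [DecidableEq γ] (N : ℕ) (ι : γ → α) (φ : NCSeries γ ℝ) :
    tn N (emb ι φ) ≤ pushConst (embMat ι) ^ N * tn N φ := tn_push_le N _ φ

end Emb


end NCSeries

end Literature.NumberTheory.Transcendental
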